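import Literature.Analysis.FluidPDE.KwonCommutatorFields
import Literature.Analysis.FluidPDE.KwonConvectiveTransposes
import Literature.Analysis.FluidPDE.KwonRieszPressurePiece
import HarnessLib

/-!
# Kwon's Lemma 2.5 at one time slice: the Navier–Stokes pairing with `ζ_ξ` is the perturbed
# Navier–Stokes pairing with `ξ`

Analysis/FluidPDE file on the discharge path of the named fact
`Literature.Analysis.FluidPDE.kwon2023_velocity_epsilon_regularity`
(`PressureFreeEpsilonRegularity.lean`; H. Kwon, J. Differential Equations (2023) =
arXiv:2104.03160, Thm. 1.4), ninth brick of Lemma 2.5 — the purely spatial core of its proof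
(arXiv p. 8–9: "(NS) in `Q₂` with `Z = ζ` can be rewritten as (per.NS) for `v` on `B₁` …
To summarize, `v` solves (per.NS) in `(−4,0) × B₁` in distribution sense with `q = …`,
`f = …`"). At a fixed time the Navier–Stokes weak form tested with `Z(t,·) = ζ_{Ξ(t,·)}` pairs the
slice `U = u(t)` (on `B₂`, zero outside) with `ζ_η` (`η = ∂ₜΞ(t)`, since `∂ₜζ_Ξ = ζ_{∂ₜΞ}`),
with `(U·∇)ζ_ξ` and with `Δζ_ξ` (`ξ = Ξ(t)`; the pressure slot vanishes, `div ζ_ξ = 0`). With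
`h = H U` (`KwonHarmonicPart`), `v = U − h`, and the EXPLICIT slice pressure and force

* `kwonSlicePressure U = q₀ − P_{(U·∇φ)U} − Σᵢ (∂ᵢk) ⋆ ((UᵢU)·∇φ) + π[F]`,
* `kwonSliceForce U = −T'_{K_Δ}U − Σᵢ T'_{Kᵢ}(UᵢU) − Σᵢ curl((∂ᵢk) ⋆ (∇φ × UᵢU)) − P[F]`

(`q₀ = czPressure U` the Calderón–Zygmund piece, `P_g = shellPressure g`, `F = φ♭(h·∇)h`,
`T'_K` the transposed commutators, `P`/`π` the classical Leray projection / divergence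
potential), the main theorem `slice_momentum_identity` states

`∫ ⟪U, ζ_η⟫ + ∫ ⟪U, (U·∇)ζ_ξ⟫ + ∫ ⟪U, Δζ_ξ⟫`
`= ∫ ⟪v, η⟫ + ∫ ⟪v, (v·∇)ξ⟫ + ∫ ⟪h, (v·∇)ξ⟫ + ∫ ⟪v, (h·∇)ξ⟫ + ∫ ⟪v, Δξ⟫ + ∫ q_U div ξ + ∫ ⟪f_U, ξ⟫`

for `U ∈ L¹ ∩ L² ∩ L³`, `ξ, η ∈ C^∞` supported in `B̄_r`, `r < 1`, and `U` killing the two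
gradients `∇(φ div A_η)`, `∇(φ div A_{Δξ})` (its weak divergence-free condition on `B₂` at
the two test functions involved) — i.e. the integrand of Kwon's (per.NS) for `v` with drift `h`
(`Kwon2023.IsPerturbedSuitableOn`, `λ = 1`), slot by slot:

* **(T)** `integral_inner_testField_of_div`: `∫ ⟪U, ζ_η⟫ = ∫ ⟪U, η⟫ − ∫ ⟪h, η⟫` (duality);
* **(L)** `integral_inner_laplacian_testField`: `∫ ⟪U, Δζ_ξ⟫ = ∫ ⟪U, Δξ⟫ − ∫ ⟪T'_{K_Δ}U, ξ⟫`
  (`Δζ_ξ = ζ_{Δξ} − curl W_ξ`, duality, `∫ ⟪h, Δξ⟫ = 0` by Green and `Δh = 0` on `B₁`);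
* **(N)** `integral_inner_convect_testField`: `∫ ⟪U, (U·∇)ζ_ξ⟫ = ∫ ⟪U, (U·∇)ξ⟫ +`
  `∫ (q₀ − P − Σ Pᴴᵢ) div ξ − Σ ∫ ⟪Fᴴᵢ, ξ⟫ − Σ ∫ ⟪T'_{Kᵢ}(UᵢU), ξ⟫` (coordinate expansion,
  `∂ᵢζ_ξ = ζ_{∂ᵢξ} − curl((∂ᵢφ)curl A_ξ)`, duality for the densities `UᵢU`, the bricks (N2), (N3)
  and the Riesz pressure piece); then `U = v + h` (`integral_inner_convect_expand`) and the
  self-interaction `∫ ⟪h,(h·∇)ξ⟫ = ∫ π[F] div ξ − ∫ ⟪P[F], ξ⟫` (hh).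

## Mathlib / tree search

Tree (reused): `integral_inner_testField_eq_sub` (`KwonLocalLerayDuality`); `laplacian_testField`,
`fderiv_testField_apply`, `contDiff_fderiv_apply_infty`, `contDiff_testField`,
`hasCompactSupport_testField` (`KwonTestField(Calculus)`); `kernelIntegralOp_commKernelDir/Lap`,
`integral_inner_curl_commDir/commLap`, `curl_commDir/commLap_eq_zero_of_not_shell`,
`continuous_curlKernelTranspose`, `continuous_curl_kernelIntegralOp` (`KwonCommutatorFields`,
`KwonKernelOperators`); `integral_inner_harmonicPart_fderiv_apply`,
`sum_integral_inner_gradient_cutoff_mul_divergence`, `integral_inner_harmonicPart_convect`,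
`inner_clm_apply_eq_sum`, `integrable_apply_mul_inner`, `shellPressure`, `selfStretch`
(`KwonConvectiveTransposes`); `czPressure`, `integral_cutoff_mul_hessian_divergence_testPotential`
(`KwonRieszPressurePiece`); `laplacian_harmonicPart_eq_zero`, `exists_norm_harmonicPart_le`
(`KwonHarmonicPart`); `integral_inner_laplacian_comm` (`ClassicalSolutionCalculus`).
Mathlib: `isBoundedBilinearMap_apply`, `integral_finsetSum`,
`LocallyIntegrable.integrable_smul_left_of_hasCompactSupport`.

## References

* H. Kwon, J. Differential Equations (2023) = arXiv:2104.03160: Lemma 2.5 and its proof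
  (arXiv p. 8–9). [Kwon2023RolePressure]
-/

noncomputable section

open MeasureTheory Set Function Filter Topology TopologicalSpace Metric InnerProductSpace
  ContinuousLinearMap
open scoped NNReal ENNReal RealInnerProductSpace Convolution Laplacian ContDiff

namespace Literature.Analysis.FluidPDE

namespace Kwon2023

variable {U ξ η : EuclideanSpace ℝ (Fin 3) → EuclideanSpace ℝ (Fin 3)} {r : ℝ}

/-! ### Test fields: supports and smoothness bookkeeping -/

/-- `tsupport (Δξ) ⊆ tsupport ξ`. [folklore] -/
theorem tsupport_laplacian_subset' (ξ : EuclideanSpace ℝ (Fin 3) → EuclideanSpace ℝ (Fin 3)) :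
    tsupport (fun y => (Δ ξ) y) ⊆ tsupport ξ :=
  closure_minimal (fun x hx => by
    by_contra h
    exact hx (laplacian_eq_zero_of_notMem_tsupport h)) (isClosed_tsupport _)

/-- `tsupport (∂ₐξ) ⊆ tsupport ξ`. [folklore] -/
theorem tsupport_fderiv_apply_subset' (ξ : EuclideanSpace ℝ (Fin 3) → EuclideanSpace ℝ (Fin 3))
    (a : EuclideanSpace ℝ (Fin 3)) : tsupport (fun y => fderiv ℝ ξ y a) ⊆ tsupport ξ :=
  tsupport_fderiv_apply_subset ℝ a

/-- `Δξ` is smooth for smooth `ξ`. [folklore] -/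
theorem contDiff_laplacian_infty (hξ : ContDiff ℝ ∞ ξ) : ContDiff ℝ ∞ fun y => (Δ ξ) y :=
  contDiff_infty.2 fun n => contDiff_laplacian (n := n) (contDiff_infty.1 hξ (n + 2))

/-! ### (T) the time-derivative slot -/

/-- **(T)**: `∫ ⟪U, ζ_η⟫ = ∫ ⟪U, η⟫ − ∫ ⟪H U, η⟫` for `U ∈ L¹(B₂)` killing the gradient
`∇(φ div A_η)` (the weak divergence-free condition at this slice and this test function).
[cite: Kwon2023RolePressure, Lemma 2.5 (proof, p. 8)] -/
theorem integral_inner_testField_of_div (hU : IntegrableOn U (ball (0 : EuclideanSpace ℝ (Fin 3)) 2))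
    (hη : ContDiff ℝ ∞ η) (hr : r < 1)
    (hηs : tsupport η ⊆ closedBall (0 : EuclideanSpace ℝ (Fin 3)) r)
    (hdiv : ∫ x, ⟪U x, gradient (fun y => kwonCutoff y *
      VectorCalculus.divergence (testPotential η) y) x⟫ = 0) :
    ∫ x, ⟪U x, testField η x⟫ = (∫ x, ⟪U x, η x⟫) - ∫ x, ⟪harmonicPart U x, η x⟫ := by
  rw [integral_inner_testField_eq_sub hU hη hr hηs, hdiv, sub_zero]

/-! ### (L) the Laplacian slot -/

/-- `∫ ⟪H U, Δξ⟫ = 0` for `ξ` supported in `B₁` (`Δ(H U) = 0` there; Green's second identity).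
[cite: Kwon2023RolePressure, Remark 2.3] -/
theorem integral_inner_harmonicPart_laplacian_eq_zero
    (hU : IntegrableOn U (ball (0 : EuclideanSpace ℝ (Fin 3)) 2)) (hξ : ContDiff ℝ ∞ ξ)
    (hξs : tsupport ξ ⊆ ball (0 : EuclideanSpace ℝ (Fin 3)) 1) :
    ∫ x, ⟪harmonicPart U x, (Δ ξ) x⟫ = 0 := by
  have hξc : HasCompactSupport ξ :=
    HasCompactSupport.of_support_subset_isCompact (isCompact_closedBall 0 1)
      ((subset_tsupport ξ).trans (hξs.trans ball_subset_closedBall))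
  have h₁ := (integrable_scalarDensity hU).locallyIntegrable
  have h₂ := (integrable_vectorDensity hU).locallyIntegrable
  rw [← integral_inner_laplacian_comm (contDiff_harmonicPart h₁ h₂) (contDiff_infty.1 hξ 2) hξc]
  refine integral_eq_zero_of_ae (Eventually.of_forall fun x => ?_)
  show ⟪(Δ (harmonicPart U)) x, ξ x⟫ = 0
  by_cases hx : x ∈ tsupport ξ
  · rw [laplacian_harmonicPart_eq_zero h₁ h₂ (mem_ball_zero_iff.1 (hξs hx)), inner_zero_left]
  · rw [image_eq_zero_of_notMem_tsupport hx, inner_zero_right]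

/-- **(L)**: `∫ ⟪U, Δζ_ξ⟫ = ∫ ⟪U, Δξ⟫ − ∫ ⟪T'_{K_Δ} U, ξ⟫` for `U ∈ L¹` supported-wise on `B₂`
(global `L¹` field vanishing where irrelevant), `ξ` supported in `B̄_r`, `r < 1`, killing the
gradient `∇(φ div A_{Δξ})`: `Δζ_ξ = ζ_{Δξ} − curl W_ξ`, duality for `ζ_{Δξ}`, harmonicity of
`H U` on `B₁`, and the transposed `Δ`-commutator. [cite: Kwon2023RolePressure, Lemma 2.5 (proof, p. 8), (err.Deu)] -/
theorem integral_inner_laplacian_testField (hU : Integrable U) (hξ : ContDiff ℝ ∞ ξ) (hr : r < 1)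
    (hξs : tsupport ξ ⊆ closedBall (0 : EuclideanSpace ℝ (Fin 3)) r)
    (hdiv : ∫ x, ⟪U x, gradient (fun y => kwonCutoff y *
      VectorCalculus.divergence (testPotential fun z => (Δ ξ) z) y) x⟫ = 0) :
    ∫ x, ⟪U x, (Δ (testField ξ)) x⟫ =
      (∫ x, ⟪U x, (Δ ξ) x⟫) - ∫ y, ⟪curlKernelTranspose commKernelLap U y, ξ y⟫ := by
  have hξc := hasCompactSupport_of_tsupport_subset_closedBall hξs
  have hξ1 : tsupport ξ ⊆ ball (0 : EuclideanSpace ℝ (Fin 3)) 1 := hξs.trans (closedBall_subset_ball hr)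
  have hΔξ : ContDiff ℝ ∞ fun y => (Δ ξ) y := contDiff_laplacian_infty hξ
  have hΔξs : tsupport (fun y => (Δ ξ) y) ⊆ closedBall (0 : EuclideanSpace ℝ (Fin 3)) r :=
    (tsupport_laplacian_subset' ξ).trans hξs
  -- split `Δζ_ξ = ζ_{Δξ} − curl W_ξ`
  have hW : Continuous (curl fun y => (2 : ℝ) • fderiv ℝ (curl (testPotential ξ)) y
      (gradient kwonCutoff y) + ((Δ kwonCutoff) y) • curl (testPotential ξ) y) := by
    have e : (fun y => (2 : ℝ) • fderiv ℝ (curl (testPotential ξ)) y (gradient kwonCutoff y)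
        + ((Δ kwonCutoff) y) • curl (testPotential ξ) y) = kernelIntegralOp commKernelLap ξ :=
      funext fun y => (kernelIntegralOp_commKernelLap hξ hr hξs y).symm
    rw [e]
    exact continuous_curl_kernelIntegralOp contDiff_uncurry_commKernelLap
      hasCompactSupport_uncurry_commKernelLap hξ.continuous hξc
  have hWc : HasCompactSupport (curl fun y => (2 : ℝ) • fderiv ℝ (curl (testPotential ξ)) y
      (gradient kwonCutoff y) + ((Δ kwonCutoff) y) • curl (testPotential ξ) y) := by
    refine HasCompactSupport.intro (isCompact_closedBall (0 : EuclideanSpace ℝ (Fin 3)) (7 / 4))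
      fun x hx => ?_
    rw [mem_closedBall_zero_iff, not_le] at hx
    exact curl_commLap_eq_zero_of_not_shell hξ hr hξs (Or.inr hx)
  have hi1 : Integrable fun x => ⟪U x, testField (fun y => (Δ ξ) y) x⟫ :=
    integrable_inner_density hU (contDiff_testField hΔξ
      (hasCompactSupport_of_tsupport_subset_closedBall hΔξs) (n := 0)).continuous hasCompactSupport_testField
  have hi2 : Integrable fun x => ⟪U x, curl (fun y => (2 : ℝ) • fderiv ℝ (curl (testPotential ξ)) y
      (gradient kwonCutoff y) + ((Δ kwonCutoff) y) • curl (testPotential ξ) y) x⟫ :=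
    integrable_inner_density hU hW hWc
  have e0 : ∫ x, ⟪U x, (Δ (testField ξ)) x⟫ = (∫ x, ⟪U x, testField (fun y => (Δ ξ) y) x⟫)
      - ∫ x, ⟪U x, curl (fun y => (2 : ℝ) • fderiv ℝ (curl (testPotential ξ)) y
          (gradient kwonCutoff y) + ((Δ kwonCutoff) y) • curl (testPotential ξ) y) x⟫ := by
    rw [← integral_sub hi1 hi2]
    refine integral_congr_ae (Eventually.of_forall fun x => ?_)
    dsimp only
    rw [← inner_sub_right, laplacian_testField hξ x]
  rw [e0, integral_inner_testField_eq_sub hU.integrableOn hΔξ hr hΔξs, hdiv, sub_zero,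
    integral_inner_harmonicPart_laplacian_eq_zero hU.integrableOn hξ hξ1, sub_zero,
    integral_inner_curl_commLap hU hξ hr hξs]

/-! ### (N) the convective slot -/

section Convective

/-- `q₀ = Π[W] − Λ[Π[W]]` is locally integrable (`Π[W] ∈ L^{3/2}`, `Λ[Π[W]]` continuous). [folklore] -/
theorem locallyIntegrable_czPressure (hU3 : MemLp U 3 volume) :
    LocallyIntegrable (czPressure U) volume := by
  have h32 : (1 : ℝ≥0∞) ≤ 3 / 2 := by
    rw [ENNReal.le_div_iff_mul_le (by norm_num) (by norm_num)]; norm_num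
  have hPloc : LocallyIntegrable (rieszPressure (sqrtCutoffSMul U)) volume :=
    (memLp_rieszPressure (memLp_sqrtCutoffSMul hU3)).locallyIntegrable h32
  have hΛP : Continuous (newtonFarSmoothing 3 4 (rieszPressure (sqrtCutoffSMul U))) := by
    rw [newtonFarSmoothing_eq_convolution]
    exact (hasCompactSupport_newtonFarLaplacian (by norm_num) (by norm_num)).continuous_convolution_left
      _ (continuous_newtonFarLaplacian (by norm_num) (by norm_num)) hPloc
  exact hPloc.sub hΛP.locallyIntegrable

/-- The convective densities `wᵢ = Uᵢ U` are integrable for `U ∈ L²`. [folklore] -/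
theorem integrable_coord_smul (hUm : AEStronglyMeasurable U volume)
    (hU2 : Integrable fun x => ‖U x‖ ^ 2) (i : Fin 3) : Integrable fun x => U x i • U x := by
  have hm : AEStronglyMeasurable (fun x => U x i • U x) volume :=
    ((EuclideanSpace.proj i).continuous.comp_aestronglyMeasurable hUm).smul hUm
  refine Integrable.mono' hU2 hm (Eventually.of_forall fun x => ?_)
  rw [norm_smul]
  calc ‖U x i‖ * ‖U x‖ ≤ ‖U x‖ * ‖U x‖ :=
        mul_le_mul_of_nonneg_right (by simpa using PiLp.norm_apply_le (p := 2) (U x) i) (norm_nonneg _)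
    _ = ‖U x‖ ^ 2 := by ring

variable (U) in
/-- **Kwon's slice pressure** `q_U` (the `ξ`-independent pressure of the perturbed system at one
time): the Calderón–Zygmund piece `q₀`, minus the shell pressure of `(U·∇φ)U`, minus the
harmonic-part pressures of the convective densities `UᵢU`, plus the divergence potential of the
cut-off self-stretching `F = φ♭(h·∇)h`. [cite: Kwon2023RolePressure, Lemma 2.5 (proof, p. 8–9)] -/
def kwonSlicePressure (y : EuclideanSpace ℝ (Fin 3)) : ℝ :=
  czPressure U y - shellPressure (fun x => scalarDensity U x • U x) y
    - ∑ i, ((fun z => fderiv ℝ annularKernel z (EuclideanSpace.single (i : Fin 3) (1 : ℝ))) ⋆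
        scalarDensity (fun x => U x i • U x)) y
    + divPotential (selfStretch U) y

variable (U) in
/-- **Kwon's slice force** `f_U` (divergence free): minus the transposed `Δ`-commutator of `U`,
minus the transposed `∂ᵢ`-commutators of the convective densities, minus their harmonic-part curl
forces, minus the Leray projection of the cut-off self-stretching. [cite: Kwon2023RolePressure, Lemma 2.5 (proof, p. 8–9), (err.Deu)] -/
def kwonSliceForce (y : EuclideanSpace ℝ (Fin 3)) : EuclideanSpace ℝ (Fin 3) :=
  -(curlKernelTranspose commKernelLap U y)
    - ∑ i, curlKernelTranspose (commKernelDir (EuclideanSpace.single (i : Fin 3) (1 : ℝ)))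
        (fun x => U x i • U x) y
    - ∑ i, curl ((fun z => fderiv ℝ annularKernel z (EuclideanSpace.single (i : Fin 3) (1 : ℝ)))
        ⋆[lsmul ℝ ℝ, volume] vectorDensity (fun x => U x i • U x)) y
    - classicalLerayProj (selfStretch U) y

/-- **(N), first form**: for `U ∈ L¹ ∩ L² ∩ L³` and `ξ ∈ C^∞` supported in `B̄_r`, `r < 1`,
`∫ ⟪U, (U·∇)ζ_ξ⟫ = ∫ ⟪U, (U·∇)ξ⟫ + ∫ (q₀ − P_{(U·∇φ)U} − Σᵢ Pᴴᵢ) div ξ`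
`− Σᵢ ∫ ⟪Fᴴᵢ, ξ⟫ − Σᵢ ∫ ⟪T'_{Kᵢ}(UᵢU), ξ⟫`. [cite: Kwon2023RolePressure, Lemma 2.5 (proof, p. 8)] -/
theorem integral_inner_convect_testField (hUm : AEStronglyMeasurable U volume)
    (hU2 : Integrable fun x => ‖U x‖ ^ 2) (hU3 : MemLp U 3 volume) (hξ : ContDiff ℝ ∞ ξ)
    (hr : r < 1) (hξs : tsupport ξ ⊆ closedBall (0 : EuclideanSpace ℝ (Fin 3)) r) :
    ∫ x, ⟪U x, fderiv ℝ (testField ξ) x (U x)⟫ =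
      (∫ x, ⟪U x, fderiv ℝ ξ x (U x)⟫)
      + (∫ y, (czPressure U y - shellPressure (fun x => scalarDensity U x • U x) y
          - ∑ i, ((fun z => fderiv ℝ annularKernel z (EuclideanSpace.single (i : Fin 3) (1 : ℝ))) ⋆
              scalarDensity (fun x => U x i • U x)) y) * VectorCalculus.divergence ξ y)
      - (∑ i, ∫ y, ⟪curl ((fun z => fderiv ℝ annularKernel z (EuclideanSpace.single (i : Fin 3) (1 : ℝ)))
          ⋆[lsmul ℝ ℝ, volume] vectorDensity (fun x => U x i • U x)) y, ξ y⟫)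
      - ∑ i, ∫ y, ⟪curlKernelTranspose (commKernelDir (EuclideanSpace.single (i : Fin 3) (1 : ℝ)))
          (fun x => U x i • U x) y, ξ y⟫ := by
  have hξc := hasCompactSupport_of_tsupport_subset_closedBall hξs
  -- the convective densities and the derivative test fields
  have hw : ∀ i : Fin 3, Integrable fun x => U x i • U x := integrable_coord_smul hUm hU2
  have hξi : ∀ i : Fin 3, ContDiff ℝ ∞ fun y => fderiv ℝ ξ y (EuclideanSpace.single i (1 : ℝ)) :=
    fun i => contDiff_fderiv_apply_infty hξ _
  have hξis : ∀ i : Fin 3, tsupport (fun y => fderiv ℝ ξ y (EuclideanSpace.single i (1 : ℝ))) ⊆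
      closedBall (0 : EuclideanSpace ℝ (Fin 3)) r := fun i => (tsupport_fderiv_apply_subset' ξ _).trans hξs
  -- (A) coordinate expansion `⟪U, Dζ(U)⟫ = Σᵢ Uᵢ ⟪U, ∂ᵢζ⟫`, and `∂ᵢζ = ζ_{∂ᵢξ} − Sᵢ`
  have hζ : ContDiff ℝ ∞ (testField ξ) := contDiff_testField hξ hξc
  have hSi : ∀ i : Fin 3, (fun y => fderiv ℝ kwonCutoff y (EuclideanSpace.single i (1 : ℝ)) •
      curl (testPotential ξ) y) = kernelIntegralOp (commKernelDir (EuclideanSpace.single i (1 : ℝ))) ξ :=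
    fun i => funext fun y => (kernelIntegralOp_commKernelDir hξ hr hξs _ y).symm
  have hScont : ∀ i : Fin 3, Continuous (curl fun y => fderiv ℝ kwonCutoff y
      (EuclideanSpace.single i (1 : ℝ)) • curl (testPotential ξ) y) := fun i => by
    rw [hSi i]
    exact continuous_curl_kernelIntegralOp (contDiff_uncurry_commKernelDir _)
      (hasCompactSupport_uncurry_commKernelDir _) hξ.continuous hξc
  have hSc : ∀ i : Fin 3, HasCompactSupport (curl fun y => fderiv ℝ kwonCutoff y
      (EuclideanSpace.single i (1 : ℝ)) • curl (testPotential ξ) y) := fun i => by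
    refine HasCompactSupport.intro (isCompact_closedBall (0 : EuclideanSpace ℝ (Fin 3)) (7 / 4))
      fun x hx => ?_
    rw [mem_closedBall_zero_iff, not_le] at hx
    exact curl_commDir_eq_zero_of_not_shell hξ hr hξs _ (Or.inr hx)
  have hint_a : ∀ i : Fin 3, Integrable fun x => ⟪U x i • U x,
      testField (fun y => fderiv ℝ ξ y (EuclideanSpace.single i (1 : ℝ))) x⟫ := fun i =>
    integrable_inner_density (hw i) (contDiff_testField (hξi i)
      (hasCompactSupport_of_tsupport_subset_closedBall (hξis i)) (n := 0)).continuous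
      hasCompactSupport_testField
  have hint_b : ∀ i : Fin 3, Integrable fun x => ⟪U x i • U x, curl (fun y => fderiv ℝ kwonCutoff y
      (EuclideanSpace.single i (1 : ℝ)) • curl (testPotential ξ) y) x⟫ := fun i =>
    integrable_inner_density (hw i) (hScont i) (hSc i)
  have eA : ∫ x, ⟪U x, fderiv ℝ (testField ξ) x (U x)⟫ =
      ∑ i, ((∫ x, ⟪U x i • U x, testField (fun y => fderiv ℝ ξ y (EuclideanSpace.single i (1 : ℝ))) x⟫)
        - ∫ x, ⟪U x i • U x, curl (fun y => fderiv ℝ kwonCutoff y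
            (EuclideanSpace.single i (1 : ℝ)) • curl (testPotential ξ) y) x⟫) := by
    have hpt : ∀ x, ⟪U x, fderiv ℝ (testField ξ) x (U x)⟫ =
        ∑ i, (⟪U x i • U x, testField (fun y => fderiv ℝ ξ y (EuclideanSpace.single i (1 : ℝ))) x⟫
          - ⟪U x i • U x, curl (fun y => fderiv ℝ kwonCutoff y
              (EuclideanSpace.single i (1 : ℝ)) • curl (testPotential ξ) y) x⟫) := fun x => by
      rw [inner_clm_apply_eq_sum]
      refine Finset.sum_congr rfl fun i _ => ?_
      rw [fderiv_testField_apply hξ x, inner_sub_right, inner_smul_left, inner_smul_left,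
        RCLike.conj_to_real, mul_sub]
    have hint_ab : ∀ i : Fin 3, Integrable fun x => ⟪U x i • U x, testField (fun y => fderiv ℝ ξ y
        (EuclideanSpace.single i (1 : ℝ))) x⟫ - ⟪U x i • U x, curl (fun y => fderiv ℝ kwonCutoff y
          (EuclideanSpace.single i (1 : ℝ)) • curl (testPotential ξ) y) x⟫ := fun i => (hint_a i).sub (hint_b i)
    rw [integral_congr_ae (Eventually.of_forall hpt),
      integral_finsetSum _ fun i _ => hint_ab i]
    exact Finset.sum_congr rfl fun i _ => integral_sub (hint_a i) (hint_b i)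
  -- (B) duality for each `ζ_{∂ᵢξ}` and the transposed commutators
  have eB : ∀ i : Fin 3,
      (∫ x, ⟪U x i • U x, testField (fun y => fderiv ℝ ξ y (EuclideanSpace.single i (1 : ℝ))) x⟫) =
        (∫ x, ⟪U x i • U x, fderiv ℝ ξ x (EuclideanSpace.single i (1 : ℝ))⟫)
        - (∫ x, ⟪U x i • U x, gradient (fun y => kwonCutoff y * VectorCalculus.divergence
            (testPotential fun z => fderiv ℝ ξ z (EuclideanSpace.single i (1 : ℝ))) y) x⟫)
        - ∫ x, ⟪harmonicPart (fun x => U x i • U x) x, fderiv ℝ ξ x (EuclideanSpace.single i (1 : ℝ))⟫ :=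
    fun i => integral_inner_testField_eq_sub (hw i).integrableOn (hξi i) hr (hξis i)
  have eC : ∀ i : Fin 3, ∫ x, ⟪U x i • U x, curl (fun y => fderiv ℝ kwonCutoff y
      (EuclideanSpace.single i (1 : ℝ)) • curl (testPotential ξ) y) x⟫ =
      ∫ y, ⟪curlKernelTranspose (commKernelDir (EuclideanSpace.single i (1 : ℝ)))
        (fun x => U x i • U x) y, ξ y⟫ := fun i => integral_inner_curl_commDir (hw i) hξ hr hξs _
  -- (C) the three sums
  have eD : ∑ i : Fin 3, ∫ x, ⟪U x i • U x, fderiv ℝ ξ x (EuclideanSpace.single i (1 : ℝ))⟫ =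
      ∫ x, ⟪U x, fderiv ℝ ξ x (U x)⟫ := by
    have hi : ∀ i : Fin 3, Integrable fun x => ⟪U x i • U x, fderiv ℝ ξ x (EuclideanSpace.single i (1 : ℝ))⟫ :=
      fun i => integrable_inner_density (hw i) (hξi i).continuous
        (hasCompactSupport_of_tsupport_subset_closedBall (hξis i))
    rw [← integral_finsetSum _ fun i _ => hi i]
    refine integral_congr_ae (Eventually.of_forall fun x => ?_)
    dsimp only
    rw [inner_clm_apply_eq_sum (fderiv ℝ ξ x) (U x)]
    refine Finset.sum_congr rfl fun i _ => ?_
    rw [inner_smul_left, RCLike.conj_to_real]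
  have eE : ∑ i : Fin 3, ∫ x, ⟪U x i • U x, gradient (fun y => kwonCutoff y * VectorCalculus.divergence
      (testPotential fun z => fderiv ℝ ξ z (EuclideanSpace.single i (1 : ℝ))) y) x⟫ =
      (∫ y, shellPressure (fun x => scalarDensity U x • U x) y * VectorCalculus.divergence ξ y)
        - ∫ y, czPressure U y * VectorCalculus.divergence ξ y := by
    have h := sum_integral_inner_gradient_cutoff_mul_divergence hUm hU2 hξ hr hξs
    have h' : ∀ i : Fin 3, (∫ x, ⟪U x i • U x, gradient (fun y => kwonCutoff y * VectorCalculus.divergence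
        (testPotential fun z => fderiv ℝ ξ z (EuclideanSpace.single i (1 : ℝ))) y) x⟫) =
        ∫ x, U x i * ⟪U x, gradient (fun y => kwonCutoff y * VectorCalculus.divergence
          (testPotential fun z => fderiv ℝ ξ z (EuclideanSpace.single i (1 : ℝ))) y) x⟫ := fun i =>
      integral_congr_ae (Eventually.of_forall fun x => by
        simp only [inner_smul_left, RCLike.conj_to_real])
    simp_rw [h']
    rw [h, integral_cutoff_mul_hessian_divergence_testPotential hU3 hξ hξc, sub_eq_add_neg]
  have eF : ∀ i : Fin 3, ∫ x, ⟪harmonicPart (fun x => U x i • U x) x,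
      fderiv ℝ ξ x (EuclideanSpace.single i (1 : ℝ))⟫ =
      (∫ y, ((fun z => fderiv ℝ annularKernel z (EuclideanSpace.single i (1 : ℝ))) ⋆
          scalarDensity (fun x => U x i • U x)) y * VectorCalculus.divergence ξ y)
        + ∫ y, ⟪curl ((fun z => fderiv ℝ annularKernel z (EuclideanSpace.single i (1 : ℝ)))
            ⋆[lsmul ℝ ℝ, volume] vectorDensity (fun x => U x i • U x)) y, ξ y⟫ := fun i =>
    integral_inner_harmonicPart_fderiv_apply (hw i).integrableOn hξ hξc _
  -- integrability of the pressure densities against `div ξ`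
  have hσ : Continuous fun y => VectorCalculus.divergence ξ y :=
    (contDiff_divergence_succ (n := 0) (contDiff_infty.1 hξ 1)).continuous
  have hσc : HasCompactSupport fun y => VectorCalculus.divergence ξ y := hasCompactSupport_divergence_of hξc
  have hiq0 : Integrable fun y => czPressure U y * VectorCalculus.divergence ξ y := by
    simpa only [smul_eq_mul, mul_comm] using
      (locallyIntegrable_czPressure hU3).integrable_smul_left_of_hasCompactSupport hσ hσc
  have hiP : Integrable fun y => shellPressure (fun x => scalarDensity U x • U x) y *
      VectorCalculus.divergence ξ y :=
    ((continuous_shellPressure (integrable_scalarDensity_smul hUm hU2)).mul hσ)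
      |>.integrable_of_hasCompactSupport hσc.mul_left
  have hiH : ∀ i : Fin 3, Integrable fun y => ((fun z => fderiv ℝ annularKernel z
      (EuclideanSpace.single i (1 : ℝ))) ⋆ scalarDensity (fun x => U x i • U x)) y *
        VectorCalculus.divergence ξ y := fun i => by
    refine (Continuous.mul ?_ hσ).integrable_of_hasCompactSupport hσc.mul_left
    exact (hasCompactSupport_annularKernel.fderiv_apply (𝕜 := ℝ) _).continuous_convolution_left _
      ((contDiff_annularKernel (n := 1)).continuous_fderiv one_ne_zero |>.clm_apply continuous_const)
      (integrable_scalarDensity (hw i).integrableOn).locallyIntegrable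
  -- assemble
  rw [eA]
  simp_rw [eB, eC, eF]
  rw [Finset.sum_sub_distrib]
  simp only [Finset.sum_sub_distrib, Finset.sum_add_distrib]
  rw [eD, eE]
  -- the pressure integral of the combination
  have eq : ∫ y, (czPressure U y - shellPressure (fun x => scalarDensity U x • U x) y
      - ∑ i, ((fun z => fderiv ℝ annularKernel z (EuclideanSpace.single (i : Fin 3) (1 : ℝ))) ⋆
          scalarDensity (fun x => U x i • U x)) y) * VectorCalculus.divergence ξ y =
      (∫ y, czPressure U y * VectorCalculus.divergence ξ y)
        - (∫ y, shellPressure (fun x => scalarDensity U x • U x) y * VectorCalculus.divergence ξ y)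
        - ∑ i, ∫ y, ((fun z => fderiv ℝ annularKernel z (EuclideanSpace.single (i : Fin 3) (1 : ℝ))) ⋆
            scalarDensity (fun x => U x i • U x)) y * VectorCalculus.divergence ξ y := by
    have hS : Integrable fun y => ∑ i, ((fun z => fderiv ℝ annularKernel z
        (EuclideanSpace.single (i : Fin 3) (1 : ℝ))) ⋆ scalarDensity (fun x => U x i • U x)) y *
          VectorCalculus.divergence ξ y := integrable_finsetSum _ fun i _ => hiH i
    have hD : Integrable fun y => czPressure U y * VectorCalculus.divergence ξ y -
        shellPressure (fun x => scalarDensity U x • U x) y * VectorCalculus.divergence ξ y := hiq0.sub hiP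
    have e : ∀ y, (czPressure U y - shellPressure (fun x => scalarDensity U x • U x) y
        - ∑ i, ((fun z => fderiv ℝ annularKernel z (EuclideanSpace.single (i : Fin 3) (1 : ℝ))) ⋆
            scalarDensity (fun x => U x i • U x)) y) * VectorCalculus.divergence ξ y =
        (czPressure U y * VectorCalculus.divergence ξ y -
          shellPressure (fun x => scalarDensity U x • U x) y * VectorCalculus.divergence ξ y)
        - ∑ i, ((fun z => fderiv ℝ annularKernel z (EuclideanSpace.single (i : Fin 3) (1 : ℝ))) ⋆
            scalarDensity (fun x => U x i • U x)) y * VectorCalculus.divergence ξ y := fun y => by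
      rw [sub_mul, sub_mul, Finset.sum_mul]
    simp_rw [e]
    rw [integral_sub hD hS, integral_sub hiq0 hiP, integral_finsetSum _ fun i _ => hiH i]
  rw [eq]
  ring

end Convective

/-! ### The slice identity -/

section Assembly

/-- `∫ ⟪U, G⟫` splits as `∫ ⟪U − H U, G⟫ + ∫ ⟪H U, G⟫` against a continuous compactly supported
`G`, for `U ∈ L¹(B₂)` (global `L¹`). [folklore] -/
theorem integral_inner_sub_harmonicPart (hU1 : Integrable U)
    {G : EuclideanSpace ℝ (Fin 3) → EuclideanSpace ℝ (Fin 3)} (hG : Continuous G)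
    (hGc : HasCompactSupport G) :
    ∫ x, ⟪U x - harmonicPart U x, G x⟫ = (∫ x, ⟪U x, G x⟫) - ∫ x, ⟪harmonicPart U x, G x⟫ := by
  have h₁ := (integrable_scalarDensity hU1.integrableOn).locallyIntegrable
  have h₂ := (integrable_vectorDensity hU1.integrableOn).locallyIntegrable
  have hh : Continuous (harmonicPart U) := (contDiff_harmonicPart h₁ h₂ (n := 0)).continuous
  rw [← integral_sub (integrable_inner_density hU1 hG hGc)
    ((hh.inner (𝕜 := ℝ) hG).integrable_of_hasCompactSupport (hGc.mono support_inner_subset_right))]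
  refine integral_congr_ae (Eventually.of_forall fun x => ?_)
  dsimp only
  rw [inner_sub_left]

/-- **Expansion of the convective pairing under `U = v + h`**:
`∫ ⟪U, (U·∇)ξ⟫ = ∫ ⟪v, (v·∇)ξ⟫ + ∫ ⟪h, (v·∇)ξ⟫ + ∫ ⟪v, (h·∇)ξ⟫ + ∫ ⟪h, (h·∇)ξ⟫`, `v = U − h`,
all four pairings being integrable for `U ∈ L¹ ∩ L²`. [folklore] -/
theorem integral_inner_convect_expand (hUm : AEStronglyMeasurable U volume) (hU1 : Integrable U)
    (hU2 : Integrable fun x => ‖U x‖ ^ 2) (hξ : ContDiff ℝ ∞ ξ) (hξc : HasCompactSupport ξ) :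
    ∫ x, ⟪U x, fderiv ℝ ξ x (U x)⟫ =
      (∫ x, ⟪U x - harmonicPart U x, fderiv ℝ ξ x (U x - harmonicPart U x)⟫)
      + (∫ x, ⟪harmonicPart U x, fderiv ℝ ξ x (U x - harmonicPart U x)⟫)
      + (∫ x, ⟪U x - harmonicPart U x, fderiv ℝ ξ x (harmonicPart U x)⟫)
      + ∫ x, ⟪harmonicPart U x, fderiv ℝ ξ x (harmonicPart U x)⟫ := by
  have h₁ := (integrable_scalarDensity hU1.integrableOn).locallyIntegrable
  have h₂ := (integrable_vectorDensity hU1.integrableOn).locallyIntegrable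
  have hh : Continuous (harmonicPart U) := (contDiff_harmonicPart h₁ h₂ (n := 0)).continuous
  obtain ⟨Ch, hCh0, hCh⟩ := exists_norm_harmonicPart_le
  have hDξ : Continuous (fderiv ℝ ξ) := (contDiff_infty.1 hξ 1).continuous_fderiv one_ne_zero
  have hDξc : HasCompactSupport (fderiv ℝ ξ) := hξc.fderiv (𝕜 := ℝ)
  obtain ⟨C, hC⟩ := hDξ.bounded_above_of_compact_support hDξc
  -- the four integrands
  have iUU : Integrable fun x => ⟪U x, fderiv ℝ ξ x (U x)⟫ := by
    have hi : ∀ i : Fin 3, Integrable fun x => U x i * ⟪U x, fderiv ℝ ξ x (EuclideanSpace.single i (1 : ℝ))⟫ :=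
      fun i => integrable_apply_mul_inner hUm hU2 (hDξ.clm_apply continuous_const)
        (hξc.fderiv_apply (𝕜 := ℝ) _) i
    refine (integrable_finsetSum (Finset.univ : Finset (Fin 3)) fun i _ => hi i).congr
      (Eventually.of_forall fun x => ?_)
    dsimp only
    rw [inner_clm_apply_eq_sum (fderiv ℝ ξ x) (U x)]
  have iUh : Integrable fun x => ⟪U x, fderiv ℝ ξ x (harmonicPart U x)⟫ :=
    integrable_inner_density hU1 (hDξ.clm_apply hh) (hDξc.mono fun x hx => by
      contrapose! hx; simp only [mem_support, not_not] at hx ⊢; rw [hx, _root_.zero_apply])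
  have ihU : Integrable fun x => ⟪harmonicPart U x, fderiv ℝ ξ x (U x)⟫ := by
    have hDU : AEStronglyMeasurable (fun x => fderiv ℝ ξ x (U x)) volume :=
      (isBoundedBilinearMap_apply (𝕜 := ℝ) (E := EuclideanSpace ℝ (Fin 3))
        (F := EuclideanSpace ℝ (Fin 3))).continuous.comp_aestronglyMeasurable
        (hDξ.aestronglyMeasurable.prodMk hUm)
    have hm : AEStronglyMeasurable (fun x => ⟪harmonicPart U x, fderiv ℝ ξ x (U x)⟫) volume :=
      hh.aestronglyMeasurable.inner (𝕜 := ℝ) hDU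
    refine Integrable.mono' ((hU1.norm.const_mul (Ch * (∫ y in ball (0 : EuclideanSpace ℝ (Fin 3)) 2,
      ‖U y‖) * C))) hm (Eventually.of_forall fun x => ?_)
    calc ‖⟪harmonicPart U x, fderiv ℝ ξ x (U x)⟫‖ ≤ ‖harmonicPart U x‖ * ‖fderiv ℝ ξ x (U x)‖ :=
          norm_inner_le_norm _ _
      _ ≤ (Ch * ∫ y in ball (0 : EuclideanSpace ℝ (Fin 3)) 2, ‖U y‖) * (C * ‖U x‖) :=
          mul_le_mul (hCh U hU1.integrableOn x) (((fderiv ℝ ξ x).le_opNorm _).trans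
            (mul_le_mul_of_nonneg_right (hC x) (norm_nonneg _))) (norm_nonneg _)
            (mul_nonneg hCh0 (integral_nonneg fun _ => norm_nonneg _))
      _ = Ch * (∫ y in ball (0 : EuclideanSpace ℝ (Fin 3)) 2, ‖U y‖) * C * ‖U x‖ := by ring
  have ihh : Integrable fun x => ⟪harmonicPart U x, fderiv ℝ ξ x (harmonicPart U x)⟫ :=
    (hh.inner (𝕜 := ℝ) (hDξ.clm_apply hh)).integrable_of_hasCompactSupport
      (hDξc.mono fun x hx => by
        contrapose! hx; simp only [mem_support, not_not] at hx ⊢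
        rw [hx, _root_.zero_apply, inner_zero_right])
  have ivv : Integrable fun x => ⟪U x - harmonicPart U x, fderiv ℝ ξ x (U x - harmonicPart U x)⟫ := by
    refine (((iUU.sub iUh).sub ihU).add ihh).congr (Eventually.of_forall fun x => ?_)
    simp only [Pi.add_apply, Pi.sub_apply, map_sub, inner_sub_left, inner_sub_right]
    ring
  have ihv : Integrable fun x => ⟪harmonicPart U x, fderiv ℝ ξ x (U x - harmonicPart U x)⟫ := by
    refine (ihU.sub ihh).congr (Eventually.of_forall fun x => ?_)
    simp only [Pi.sub_apply, map_sub, inner_sub_right]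
  have ivh : Integrable fun x => ⟪U x - harmonicPart U x, fderiv ℝ ξ x (harmonicPart U x)⟫ := by
    refine (iUh.sub ihh).congr (Eventually.of_forall fun x => ?_)
    simp only [Pi.sub_apply, inner_sub_left]
  have h12 : Integrable fun x => ⟪U x - harmonicPart U x, fderiv ℝ ξ x (U x - harmonicPart U x)⟫
      + ⟪harmonicPart U x, fderiv ℝ ξ x (U x - harmonicPart U x)⟫ := ivv.add ihv
  have h123 : Integrable fun x => ⟪U x - harmonicPart U x, fderiv ℝ ξ x (U x - harmonicPart U x)⟫
      + ⟪harmonicPart U x, fderiv ℝ ξ x (U x - harmonicPart U x)⟫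
      + ⟪U x - harmonicPart U x, fderiv ℝ ξ x (harmonicPart U x)⟫ := h12.add ivh
  have e : ∀ x, ⟪U x, fderiv ℝ ξ x (U x)⟫ =
      ⟪U x - harmonicPart U x, fderiv ℝ ξ x (U x - harmonicPart U x)⟫
      + ⟪harmonicPart U x, fderiv ℝ ξ x (U x - harmonicPart U x)⟫
      + ⟪U x - harmonicPart U x, fderiv ℝ ξ x (harmonicPart U x)⟫
      + ⟪harmonicPart U x, fderiv ℝ ξ x (harmonicPart U x)⟫ := fun x => by
    simp only [map_sub, inner_sub_left, inner_sub_right]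
    ring
  simp_rw [e]
  rw [integral_add h123 ihh, integral_add h12 ivh, integral_add ivv ihv]

/-- **Kwon's Lemma 2.5 at one time slice.** For a slice `U ∈ L¹ ∩ L² ∩ L³(ℝ³)` (the velocity
on `B₂`, extended by zero), killing the two gradients `∇(φ div A_η)`, `∇(φ div A_{Δξ})` (its weak
divergence-free condition on `B₂` at the two test functions involved), and test fields
`ξ, η ∈ C^∞` supported in `B̄_r`, `r < 1`: with `h = H U`, `v = U − h`, `q_U = kwonSlicePressure U`,
`f_U = kwonSliceForce U`,
`∫ ⟪U, ζ_η⟫ + ∫ ⟪U, (U·∇)ζ_ξ⟫ + ∫ ⟪U, Δζ_ξ⟫`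
`= ∫ ⟪v, η⟫ + ∫ ⟪v, (v·∇)ξ⟫ + ∫ ⟪h, (v·∇)ξ⟫ + ∫ ⟪v, (h·∇)ξ⟫ + ∫ ⟪v, Δξ⟫ + ∫ q_U div ξ + ∫ ⟪f_U, ξ⟫`
— the Navier–Stokes pairing of `U` with `(ζ_η, ζ_ξ)` in the slots `(∂ₜ, ∇, Δ)` is the
perturbed Navier–Stokes pairing of `v` with `(η, ξ)`. [cite: Kwon2023RolePressure, Lemma 2.5] -/
theorem slice_momentum_identity (hUm : AEStronglyMeasurable U volume) (hU1 : Integrable U)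
    (hU2 : Integrable fun x => ‖U x‖ ^ 2) (hU3 : MemLp U 3 volume)
    (hξ : ContDiff ℝ ∞ ξ) (hη : ContDiff ℝ ∞ η) (hr : r < 1)
    (hξs : tsupport ξ ⊆ closedBall (0 : EuclideanSpace ℝ (Fin 3)) r)
    (hηs : tsupport η ⊆ closedBall (0 : EuclideanSpace ℝ (Fin 3)) r)
    (hdivη : ∫ x, ⟪U x, gradient (fun y => kwonCutoff y *
      VectorCalculus.divergence (testPotential η) y) x⟫ = 0)
    (hdivΔ : ∫ x, ⟪U x, gradient (fun y => kwonCutoff y *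
      VectorCalculus.divergence (testPotential fun z => (Δ ξ) z) y) x⟫ = 0) :
    (∫ x, ⟪U x, testField η x⟫) + (∫ x, ⟪U x, fderiv ℝ (testField ξ) x (U x)⟫)
        + ∫ x, ⟪U x, (Δ (testField ξ)) x⟫ =
      (∫ x, ⟪U x - harmonicPart U x, η x⟫)
      + (∫ x, ⟪U x - harmonicPart U x, fderiv ℝ ξ x (U x - harmonicPart U x)⟫)
      + (∫ x, ⟪harmonicPart U x, fderiv ℝ ξ x (U x - harmonicPart U x)⟫)
      + (∫ x, ⟪U x - harmonicPart U x, fderiv ℝ ξ x (harmonicPart U x)⟫)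
      + (∫ x, ⟪U x - harmonicPart U x, (Δ ξ) x⟫)
      + (∫ y, kwonSlicePressure U y * VectorCalculus.divergence ξ y)
      + ∫ y, ⟪kwonSliceForce U y, ξ y⟫ := by
  have hξc := hasCompactSupport_of_tsupport_subset_closedBall hξs
  have hηc := hasCompactSupport_of_tsupport_subset_closedBall hηs
  have hξ1 : tsupport ξ ⊆ ball (0 : EuclideanSpace ℝ (Fin 3)) 1 := hξs.trans (closedBall_subset_ball hr)
  have h₁ := (integrable_scalarDensity hU1.integrableOn).locallyIntegrable
  have h₂ := (integrable_vectorDensity hU1.integrableOn).locallyIntegrable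
  have hh : Continuous (harmonicPart U) := (contDiff_harmonicPart h₁ h₂ (n := 0)).continuous
  have hw : ∀ i : Fin 3, Integrable fun x => U x i • U x := integrable_coord_smul hUm hU2
  -- (T)
  have eT : ∫ x, ⟪U x, testField η x⟫ = ∫ x, ⟪U x - harmonicPart U x, η x⟫ := by
    rw [integral_inner_testField_of_div hU1.integrableOn hη hr hηs hdivη,
      integral_inner_sub_harmonicPart hU1 hη.continuous hηc]
  -- (L)
  have eL : ∫ x, ⟪U x, (Δ (testField ξ)) x⟫ = (∫ x, ⟪U x - harmonicPart U x, (Δ ξ) x⟫)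
      - ∫ y, ⟪curlKernelTranspose commKernelLap U y, ξ y⟫ := by
    rw [integral_inner_laplacian_testField hU1 hξ hr hξs hdivΔ,
      integral_inner_sub_harmonicPart hU1 (contDiff_laplacian_infty hξ).continuous
        (hasCompactSupport_of_tsupport_subset_closedBall ((tsupport_laplacian_subset' ξ).trans hξs)),
      integral_inner_harmonicPart_laplacian_eq_zero hU1.integrableOn hξ hξ1, sub_zero]
  -- (N)
  have eN := integral_inner_convect_testField hUm hU2 hU3 hξ hr hξs
  have eX := integral_inner_convect_expand hUm hU1 hU2 hξ hξc
  have eH := integral_inner_harmonicPart_convect hU1.integrableOn hξ hξ1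
  -- integrability of the pressure and force pieces against `ξ`
  have hσ : Continuous fun y => VectorCalculus.divergence ξ y :=
    (contDiff_divergence_succ (n := 0) (contDiff_infty.1 hξ 1)).continuous
  have hσc : HasCompactSupport fun y => VectorCalculus.divergence ξ y := hasCompactSupport_divergence_of hξc
  have hF : ContDiff ℝ ∞ (selfStretch U) := contDiff_selfStretch hU1.integrableOn
  have hFc : HasCompactSupport (selfStretch U) := hasCompactSupport_selfStretch
  have iq1 : Integrable fun y => (czPressure U y - shellPressure (fun x => scalarDensity U x • U x) y
      - ∑ i, ((fun z => fderiv ℝ annularKernel z (EuclideanSpace.single (i : Fin 3) (1 : ℝ))) ⋆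
          scalarDensity (fun x => U x i • U x)) y) * VectorCalculus.divergence ξ y := by
    have hq0 : Integrable fun y => czPressure U y * VectorCalculus.divergence ξ y := by
      simpa only [smul_eq_mul, mul_comm] using
        (locallyIntegrable_czPressure hU3).integrable_smul_left_of_hasCompactSupport hσ hσc
    have hP : Integrable fun y => shellPressure (fun x => scalarDensity U x • U x) y *
        VectorCalculus.divergence ξ y :=
      ((continuous_shellPressure (integrable_scalarDensity_smul hUm hU2)).mul hσ)
        |>.integrable_of_hasCompactSupport hσc.mul_left
    have hH : ∀ i : Fin 3, Integrable fun y => ((fun z => fderiv ℝ annularKernel z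
        (EuclideanSpace.single i (1 : ℝ))) ⋆ scalarDensity (fun x => U x i • U x)) y *
          VectorCalculus.divergence ξ y := fun i => by
      refine (Continuous.mul ?_ hσ).integrable_of_hasCompactSupport hσc.mul_left
      exact (hasCompactSupport_annularKernel.fderiv_apply (𝕜 := ℝ) _).continuous_convolution_left _
        ((contDiff_annularKernel (n := 1)).continuous_fderiv one_ne_zero |>.clm_apply continuous_const)
        (integrable_scalarDensity (hw i).integrableOn).locallyIntegrable
    have hS : Integrable fun y => ∑ i, ((fun z => fderiv ℝ annularKernel z
        (EuclideanSpace.single (i : Fin 3) (1 : ℝ))) ⋆ scalarDensity (fun x => U x i • U x)) y *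
          VectorCalculus.divergence ξ y := integrable_finsetSum _ fun i _ => hH i
    refine ((hq0.sub hP).sub hS).congr (Eventually.of_forall fun y => ?_)
    simp only [Pi.sub_apply, sub_mul, Finset.sum_mul]
  have iq2 : Integrable fun y => divPotential (selfStretch U) y * VectorCalculus.divergence ξ y :=
    ((contDiff_divPotential hF hFc).continuous.mul hσ).integrable_of_hasCompactSupport hσc.mul_left
  have if1 : Integrable fun y => ⟪curlKernelTranspose commKernelLap U y, ξ y⟫ :=
    ((continuous_curlKernelTranspose contDiff_uncurry_commKernelLap
      hasCompactSupport_uncurry_commKernelLap hU1).inner (𝕜 := ℝ) hξ.continuous)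
      |>.integrable_of_hasCompactSupport (hξc.mono support_inner_subset_right)
  have if2 : ∀ i : Fin 3, Integrable fun y => ⟪curlKernelTranspose (commKernelDir
      (EuclideanSpace.single i (1 : ℝ))) (fun x => U x i • U x) y, ξ y⟫ := fun i =>
    ((continuous_curlKernelTranspose (contDiff_uncurry_commKernelDir _)
      (hasCompactSupport_uncurry_commKernelDir _) (hw i)).inner (𝕜 := ℝ) hξ.continuous)
      |>.integrable_of_hasCompactSupport (hξc.mono support_inner_subset_right)
  have if3 : ∀ i : Fin 3, Integrable fun y => ⟪curl ((fun z => fderiv ℝ annularKernel z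
      (EuclideanSpace.single i (1 : ℝ))) ⋆[lsmul ℝ ℝ, volume] vectorDensity (fun x => U x i • U x)) y,
        ξ y⟫ := fun i => by
    refine (Continuous.inner (𝕜 := ℝ) ?_ hξ.continuous).integrable_of_hasCompactSupport
      (hξc.mono support_inner_subset_right)
    refine contDiff_curl (n := 0) ?_ |>.continuous
    exact (hasCompactSupport_annularKernel.fderiv_apply (𝕜 := ℝ) _).contDiff_convolution_left _
      (((contDiff_annularKernel (n := 2)).fderiv_right (m := 1) le_rfl).clm_apply contDiff_const)
      (integrable_vectorDensity (hw i).integrableOn).locallyIntegrable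
  have if4 : Integrable fun y => ⟪classicalLerayProj (selfStretch U) y, ξ y⟫ :=
    ((contDiff_classicalLerayProj hF hFc).continuous.inner (𝕜 := ℝ) hξ.continuous)
      |>.integrable_of_hasCompactSupport (hξc.mono support_inner_subset_right)
  -- the pressure and force integrals of the combinations
  have eQ : ∫ y, kwonSlicePressure U y * VectorCalculus.divergence ξ y =
      (∫ y, (czPressure U y - shellPressure (fun x => scalarDensity U x • U x) y
        - ∑ i, ((fun z => fderiv ℝ annularKernel z (EuclideanSpace.single (i : Fin 3) (1 : ℝ))) ⋆
            scalarDensity (fun x => U x i • U x)) y) * VectorCalculus.divergence ξ y)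
        + ∫ y, divPotential (selfStretch U) y * VectorCalculus.divergence ξ y := by
    rw [← integral_add iq1 iq2]
    refine integral_congr_ae (Eventually.of_forall fun y => ?_)
    dsimp only
    rw [← add_mul]
    rfl
  have eFo : ∫ y, ⟪kwonSliceForce U y, ξ y⟫ =
      -(∫ y, ⟪curlKernelTranspose commKernelLap U y, ξ y⟫)
      - (∑ i, ∫ y, ⟪curlKernelTranspose (commKernelDir (EuclideanSpace.single (i : Fin 3) (1 : ℝ)))
          (fun x => U x i • U x) y, ξ y⟫)
      - (∑ i, ∫ y, ⟪curl ((fun z => fderiv ℝ annularKernel z (EuclideanSpace.single (i : Fin 3) (1 : ℝ)))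
          ⋆[lsmul ℝ ℝ, volume] vectorDensity (fun x => U x i • U x)) y, ξ y⟫)
      - ∫ y, ⟪classicalLerayProj (selfStretch U) y, ξ y⟫ := by
    have ib : Integrable fun y => ∑ i, ⟪curlKernelTranspose (commKernelDir
        (EuclideanSpace.single (i : Fin 3) (1 : ℝ))) (fun x => U x i • U x) y, ξ y⟫ :=
      integrable_finsetSum _ fun i _ => if2 i
    have ic : Integrable fun y => ∑ i, ⟪curl ((fun z => fderiv ℝ annularKernel z
        (EuclideanSpace.single (i : Fin 3) (1 : ℝ))) ⋆[lsmul ℝ ℝ, volume]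
          vectorDensity (fun x => U x i • U x)) y, ξ y⟫ := integrable_finsetSum _ fun i _ => if3 i
    have ineg : Integrable fun y => -⟪curlKernelTranspose commKernelLap U y, ξ y⟫ := if1.neg
    have i1 : Integrable fun y => -⟪curlKernelTranspose commKernelLap U y, ξ y⟫
        - ∑ i, ⟪curlKernelTranspose (commKernelDir (EuclideanSpace.single (i : Fin 3) (1 : ℝ)))
            (fun x => U x i • U x) y, ξ y⟫ := ineg.sub ib
    have i2 : Integrable fun y => -⟪curlKernelTranspose commKernelLap U y, ξ y⟫
        - (∑ i, ⟪curlKernelTranspose (commKernelDir (EuclideanSpace.single (i : Fin 3) (1 : ℝ)))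
            (fun x => U x i • U x) y, ξ y⟫)
        - ∑ i, ⟪curl ((fun z => fderiv ℝ annularKernel z (EuclideanSpace.single (i : Fin 3) (1 : ℝ)))
            ⋆[lsmul ℝ ℝ, volume] vectorDensity (fun x => U x i • U x)) y, ξ y⟫ := i1.sub ic
    have e : ∀ y, ⟪kwonSliceForce U y, ξ y⟫ = -⟪curlKernelTranspose commKernelLap U y, ξ y⟫
        - (∑ i, ⟪curlKernelTranspose (commKernelDir (EuclideanSpace.single (i : Fin 3) (1 : ℝ)))
            (fun x => U x i • U x) y, ξ y⟫)
        - (∑ i, ⟪curl ((fun z => fderiv ℝ annularKernel z (EuclideanSpace.single (i : Fin 3) (1 : ℝ)))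
            ⋆[lsmul ℝ ℝ, volume] vectorDensity (fun x => U x i • U x)) y, ξ y⟫)
        - ⟪classicalLerayProj (selfStretch U) y, ξ y⟫ := fun y => by
      simp only [kwonSliceForce, inner_sub_left, inner_neg_left, sum_inner]
    simp_rw [e]
    rw [integral_sub i2 if4, integral_sub i1 ic, integral_sub ineg ib, integral_neg,
      integral_finsetSum _ (fun i _ => if2 i), integral_finsetSum _ (fun i _ => if3 i)]
  rw [eT, eL, eN, eX, eH, eQ, eFo]
  ring

end Assembly

/-! ### The slice identity with combined integrands -/

section Combined

/-- `x ↦ ⟪U, L(x) U⟫` is integrable for `U ∈ L²` and a continuous compactly supported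
operator field `L`. [folklore] -/
theorem integrable_inner_clm_apply_self (hUm : AEStronglyMeasurable U volume)
    (hU2 : Integrable fun x => ‖U x‖ ^ 2)
    {L : EuclideanSpace ℝ (Fin 3) → EuclideanSpace ℝ (Fin 3) →L[ℝ] EuclideanSpace ℝ (Fin 3)}
    (hL : Continuous L) (hLc : HasCompactSupport L) :
    Integrable fun x => ⟪U x, L x (U x)⟫ := by
  have hi : ∀ i : Fin 3, Integrable fun x => U x i * ⟪U x, L x (EuclideanSpace.single i (1 : ℝ))⟫ :=
    fun i => integrable_apply_mul_inner hUm hU2 (hL.clm_apply continuous_const)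
      (hLc.mono fun x hx => by
        contrapose! hx; simp only [mem_support, not_not] at hx ⊢; rw [hx, _root_.zero_apply]) i
  refine (integrable_finsetSum (Finset.univ : Finset (Fin 3)) fun i _ => hi i).congr
    (Eventually.of_forall fun x => ?_)
  dsimp only
  rw [inner_clm_apply_eq_sum (L x) (U x)]

/-- `x ↦ ⟪U − H U, G⟫` is integrable for `U ∈ L¹` and continuous compactly supported `G`.
[folklore] -/
theorem integrable_inner_sub_harmonicPart (hU1 : Integrable U)
    {G : EuclideanSpace ℝ (Fin 3) → EuclideanSpace ℝ (Fin 3)} (hG : Continuous G)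
    (hGc : HasCompactSupport G) : Integrable fun x => ⟪U x - harmonicPart U x, G x⟫ := by
  have h₁ := (integrable_scalarDensity hU1.integrableOn).locallyIntegrable
  have h₂ := (integrable_vectorDensity hU1.integrableOn).locallyIntegrable
  have hh : Continuous (harmonicPart U) := (contDiff_harmonicPart h₁ h₂ (n := 0)).continuous
  refine ((integrable_inner_density hU1 hG hGc).sub
    ((hh.inner (𝕜 := ℝ) hG).integrable_of_hasCompactSupport (hGc.mono support_inner_subset_right))).congr
    (Eventually.of_forall fun x => ?_)
  simp only [Pi.sub_apply, inner_sub_left]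

/-- The three perturbed convective pairings `⟪v, (v·∇)ξ⟫, ⟪h, (v·∇)ξ⟫, ⟪v, (h·∇)ξ⟫`, `v = U − h`,
are integrable for `U ∈ L¹ ∩ L²`. [folklore] -/
theorem integrable_perturbed_convective (hUm : AEStronglyMeasurable U volume) (hU1 : Integrable U)
    (hU2 : Integrable fun x => ‖U x‖ ^ 2) (hξ : ContDiff ℝ ∞ ξ) (hξc : HasCompactSupport ξ) :
    (Integrable fun x => ⟪U x - harmonicPart U x, fderiv ℝ ξ x (U x - harmonicPart U x)⟫) ∧
    (Integrable fun x => ⟪harmonicPart U x, fderiv ℝ ξ x (U x - harmonicPart U x)⟫) ∧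
    Integrable fun x => ⟪U x - harmonicPart U x, fderiv ℝ ξ x (harmonicPart U x)⟫ := by
  have h₁ := (integrable_scalarDensity hU1.integrableOn).locallyIntegrable
  have h₂ := (integrable_vectorDensity hU1.integrableOn).locallyIntegrable
  have hh : Continuous (harmonicPart U) := (contDiff_harmonicPart h₁ h₂ (n := 0)).continuous
  obtain ⟨Ch, hCh0, hCh⟩ := exists_norm_harmonicPart_le
  have hDξ : Continuous (fderiv ℝ ξ) := (contDiff_infty.1 hξ 1).continuous_fderiv one_ne_zero
  have hDξc : HasCompactSupport (fderiv ℝ ξ) := hξc.fderiv (𝕜 := ℝ)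
  obtain ⟨C, hC⟩ := hDξ.bounded_above_of_compact_support hDξc
  have iUU : Integrable fun x => ⟪U x, fderiv ℝ ξ x (U x)⟫ := integrable_inner_clm_apply_self hUm hU2 hDξ hDξc
  have iUh : Integrable fun x => ⟪U x, fderiv ℝ ξ x (harmonicPart U x)⟫ :=
    integrable_inner_density hU1 (hDξ.clm_apply hh) (hDξc.mono fun x hx => by
      contrapose! hx; simp only [mem_support, not_not] at hx ⊢; rw [hx, _root_.zero_apply])
  have ihU : Integrable fun x => ⟪harmonicPart U x, fderiv ℝ ξ x (U x)⟫ := by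
    have hDU : AEStronglyMeasurable (fun x => fderiv ℝ ξ x (U x)) volume :=
      (isBoundedBilinearMap_apply (𝕜 := ℝ) (E := EuclideanSpace ℝ (Fin 3))
        (F := EuclideanSpace ℝ (Fin 3))).continuous.comp_aestronglyMeasurable
        (hDξ.aestronglyMeasurable.prodMk hUm)
    have hm : AEStronglyMeasurable (fun x => ⟪harmonicPart U x, fderiv ℝ ξ x (U x)⟫) volume :=
      hh.aestronglyMeasurable.inner (𝕜 := ℝ) hDU
    refine Integrable.mono' ((hU1.norm.const_mul (Ch * (∫ y in ball (0 : EuclideanSpace ℝ (Fin 3)) 2,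
      ‖U y‖) * C))) hm (Eventually.of_forall fun x => ?_)
    calc ‖⟪harmonicPart U x, fderiv ℝ ξ x (U x)⟫‖ ≤ ‖harmonicPart U x‖ * ‖fderiv ℝ ξ x (U x)‖ :=
          norm_inner_le_norm _ _
      _ ≤ (Ch * ∫ y in ball (0 : EuclideanSpace ℝ (Fin 3)) 2, ‖U y‖) * (C * ‖U x‖) :=
          mul_le_mul (hCh U hU1.integrableOn x) (((fderiv ℝ ξ x).le_opNorm _).trans
            (mul_le_mul_of_nonneg_right (hC x) (norm_nonneg _))) (norm_nonneg _)
            (mul_nonneg hCh0 (integral_nonneg fun _ => norm_nonneg _))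
      _ = Ch * (∫ y in ball (0 : EuclideanSpace ℝ (Fin 3)) 2, ‖U y‖) * C * ‖U x‖ := by ring
  have ihh : Integrable fun x => ⟪harmonicPart U x, fderiv ℝ ξ x (harmonicPart U x)⟫ :=
    (hh.inner (𝕜 := ℝ) (hDξ.clm_apply hh)).integrable_of_hasCompactSupport
      (hDξc.mono fun x hx => by
        contrapose! hx; simp only [mem_support, not_not] at hx ⊢
        rw [hx, _root_.zero_apply, inner_zero_right])
  refine ⟨?_, ?_, ?_⟩
  · refine (((iUU.sub iUh).sub ihU).add ihh).congr (Eventually.of_forall fun x => ?_)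
    simp only [Pi.add_apply, Pi.sub_apply, map_sub, inner_sub_left, inner_sub_right]
    ring
  · refine (ihU.sub ihh).congr (Eventually.of_forall fun x => ?_)
    simp only [Pi.sub_apply, map_sub, inner_sub_right]
  · refine (iUh.sub ihh).congr (Eventually.of_forall fun x => ?_)
    simp only [Pi.sub_apply, inner_sub_left]

/-- The slice pressure pairs integrably with the divergence of a test field. [folklore] -/
theorem integrable_kwonSlicePressure_mul (hUm : AEStronglyMeasurable U volume) (hU1 : Integrable U)
    (hU2 : Integrable fun x => ‖U x‖ ^ 2) (hU3 : MemLp U 3 volume)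
    (hξ : ContDiff ℝ ∞ ξ) (hξc : HasCompactSupport ξ) :
    Integrable fun y => kwonSlicePressure U y * VectorCalculus.divergence ξ y := by
  have hw : ∀ i : Fin 3, Integrable fun x => U x i • U x := integrable_coord_smul hUm hU2
  have hσ : Continuous fun y => VectorCalculus.divergence ξ y :=
    (contDiff_divergence_succ (n := 0) (contDiff_infty.1 hξ 1)).continuous
  have hσc : HasCompactSupport fun y => VectorCalculus.divergence ξ y := hasCompactSupport_divergence_of hξc
  have hF : ContDiff ℝ ∞ (selfStretch U) := contDiff_selfStretch hU1.integrableOn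
  have hFc : HasCompactSupport (selfStretch U) := hasCompactSupport_selfStretch
  have hq0 : Integrable fun y => czPressure U y * VectorCalculus.divergence ξ y := by
    simpa only [smul_eq_mul, mul_comm] using
      (locallyIntegrable_czPressure hU3).integrable_smul_left_of_hasCompactSupport hσ hσc
  have hP : Integrable fun y => shellPressure (fun x => scalarDensity U x • U x) y *
      VectorCalculus.divergence ξ y :=
    ((continuous_shellPressure (integrable_scalarDensity_smul hUm hU2)).mul hσ)
      |>.integrable_of_hasCompactSupport hσc.mul_left
  have hH : ∀ i : Fin 3, Integrable fun y => ((fun z => fderiv ℝ annularKernel z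
      (EuclideanSpace.single i (1 : ℝ))) ⋆ scalarDensity (fun x => U x i • U x)) y *
        VectorCalculus.divergence ξ y := fun i => by
    refine (Continuous.mul ?_ hσ).integrable_of_hasCompactSupport hσc.mul_left
    exact (hasCompactSupport_annularKernel.fderiv_apply (𝕜 := ℝ) _).continuous_convolution_left _
      ((contDiff_annularKernel (n := 1)).continuous_fderiv one_ne_zero |>.clm_apply continuous_const)
      (integrable_scalarDensity (hw i).integrableOn).locallyIntegrable
  have hS : Integrable fun y => ∑ i, ((fun z => fderiv ℝ annularKernel z
      (EuclideanSpace.single (i : Fin 3) (1 : ℝ))) ⋆ scalarDensity (fun x => U x i • U x)) y *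
        VectorCalculus.divergence ξ y := integrable_finsetSum _ fun i _ => hH i
  have iq2 : Integrable fun y => divPotential (selfStretch U) y * VectorCalculus.divergence ξ y :=
    ((contDiff_divPotential hF hFc).continuous.mul hσ).integrable_of_hasCompactSupport hσc.mul_left
  refine (((hq0.sub hP).sub hS).add iq2).congr (Eventually.of_forall fun y => ?_)
  simp only [Pi.add_apply, Pi.sub_apply, kwonSlicePressure, sub_mul, add_mul, Finset.sum_mul]

/-- The slice force pairs integrably with a test field. [folklore] -/
theorem integrable_inner_kwonSliceForce (hUm : AEStronglyMeasurable U volume) (hU1 : Integrable U)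
    (hU2 : Integrable fun x => ‖U x‖ ^ 2) (hξ : ContDiff ℝ ∞ ξ) (hξc : HasCompactSupport ξ) :
    Integrable fun y => ⟪kwonSliceForce U y, ξ y⟫ := by
  have hw : ∀ i : Fin 3, Integrable fun x => U x i • U x := integrable_coord_smul hUm hU2
  have hF : ContDiff ℝ ∞ (selfStretch U) := contDiff_selfStretch hU1.integrableOn
  have hFc : HasCompactSupport (selfStretch U) := hasCompactSupport_selfStretch
  have if1 : Integrable fun y => ⟪curlKernelTranspose commKernelLap U y, ξ y⟫ :=
    ((continuous_curlKernelTranspose contDiff_uncurry_commKernelLap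
      hasCompactSupport_uncurry_commKernelLap hU1).inner (𝕜 := ℝ) hξ.continuous)
      |>.integrable_of_hasCompactSupport (hξc.mono support_inner_subset_right)
  have if2 : ∀ i : Fin 3, Integrable fun y => ⟪curlKernelTranspose (commKernelDir
      (EuclideanSpace.single i (1 : ℝ))) (fun x => U x i • U x) y, ξ y⟫ := fun i =>
    ((continuous_curlKernelTranspose (contDiff_uncurry_commKernelDir _)
      (hasCompactSupport_uncurry_commKernelDir _) (hw i)).inner (𝕜 := ℝ) hξ.continuous)
      |>.integrable_of_hasCompactSupport (hξc.mono support_inner_subset_right)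
  have if3 : ∀ i : Fin 3, Integrable fun y => ⟪curl ((fun z => fderiv ℝ annularKernel z
      (EuclideanSpace.single i (1 : ℝ))) ⋆[lsmul ℝ ℝ, volume] vectorDensity (fun x => U x i • U x)) y,
        ξ y⟫ := fun i => by
    refine (Continuous.inner (𝕜 := ℝ) ?_ hξ.continuous).integrable_of_hasCompactSupport
      (hξc.mono support_inner_subset_right)
    refine contDiff_curl (n := 0) ?_ |>.continuous
    exact (hasCompactSupport_annularKernel.fderiv_apply (𝕜 := ℝ) _).contDiff_convolution_left _
      (((contDiff_annularKernel (n := 2)).fderiv_right (m := 1) le_rfl).clm_apply contDiff_const)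
      (integrable_vectorDensity (hw i).integrableOn).locallyIntegrable
  have if4 : Integrable fun y => ⟪classicalLerayProj (selfStretch U) y, ξ y⟫ :=
    ((contDiff_classicalLerayProj hF hFc).continuous.inner (𝕜 := ℝ) hξ.continuous)
      |>.integrable_of_hasCompactSupport (hξc.mono support_inner_subset_right)
  have ib : Integrable fun y => ∑ i, ⟪curlKernelTranspose (commKernelDir
      (EuclideanSpace.single (i : Fin 3) (1 : ℝ))) (fun x => U x i • U x) y, ξ y⟫ :=
    integrable_finsetSum _ fun i _ => if2 i
  have ic : Integrable fun y => ∑ i, ⟪curl ((fun z => fderiv ℝ annularKernel z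
      (EuclideanSpace.single (i : Fin 3) (1 : ℝ))) ⋆[lsmul ℝ ℝ, volume]
        vectorDensity (fun x => U x i • U x)) y, ξ y⟫ := integrable_finsetSum _ fun i _ => if3 i
  have ineg : Integrable fun y => -⟪curlKernelTranspose commKernelLap U y, ξ y⟫ := if1.neg
  have i1 : Integrable fun y => -⟪curlKernelTranspose commKernelLap U y, ξ y⟫
      - ∑ i, ⟪curlKernelTranspose (commKernelDir (EuclideanSpace.single (i : Fin 3) (1 : ℝ)))
          (fun x => U x i • U x) y, ξ y⟫ := ineg.sub ib
  have i2 : Integrable fun y => -⟪curlKernelTranspose commKernelLap U y, ξ y⟫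
      - (∑ i, ⟪curlKernelTranspose (commKernelDir (EuclideanSpace.single (i : Fin 3) (1 : ℝ)))
          (fun x => U x i • U x) y, ξ y⟫)
      - ∑ i, ⟪curl ((fun z => fderiv ℝ annularKernel z (EuclideanSpace.single (i : Fin 3) (1 : ℝ)))
          ⋆[lsmul ℝ ℝ, volume] vectorDensity (fun x => U x i • U x)) y, ξ y⟫ := i1.sub ic
  have i3 : Integrable fun y => -⟪curlKernelTranspose commKernelLap U y, ξ y⟫
      - (∑ i, ⟪curlKernelTranspose (commKernelDir (EuclideanSpace.single (i : Fin 3) (1 : ℝ)))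
          (fun x => U x i • U x) y, ξ y⟫)
      - (∑ i, ⟪curl ((fun z => fderiv ℝ annularKernel z (EuclideanSpace.single (i : Fin 3) (1 : ℝ)))
          ⋆[lsmul ℝ ℝ, volume] vectorDensity (fun x => U x i • U x)) y, ξ y⟫)
      - ⟪classicalLerayProj (selfStretch U) y, ξ y⟫ := i2.sub if4
  refine i3.congr (Eventually.of_forall fun y => ?_)
  simp only [kwonSliceForce, inner_sub_left, inner_neg_left, sum_inner]

/-- **Kwon's slice momentum identity, combined integrands.** Under the hypotheses of
`slice_momentum_identity`,
`∫ (⟪U, ζ_η⟫ + ⟪U, (U·∇)ζ_ξ⟫ + ⟪U, Δζ_ξ⟫)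
  = ∫ (⟪v, η⟫ + ⟪v,(v·∇)ξ⟫ + ⟪h,(v·∇)ξ⟫ + ⟪v,(h·∇)ξ⟫ + ⟪v, Δξ⟩ + q_U div ξ + ⟪f_U, ξ⟫)`,
`v = U − H U`, `h = H U` (the form integrated in time in the space–time assembly).
[cite: Kwon2023RolePressure, Lemma 2.5] -/
theorem slice_momentum_identity_combined (hUm : AEStronglyMeasurable U volume) (hU1 : Integrable U)
    (hU2 : Integrable fun x => ‖U x‖ ^ 2) (hU3 : MemLp U 3 volume)
    (hξ : ContDiff ℝ ∞ ξ) (hη : ContDiff ℝ ∞ η) (hr : r < 1)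
    (hξs : tsupport ξ ⊆ closedBall (0 : EuclideanSpace ℝ (Fin 3)) r)
    (hηs : tsupport η ⊆ closedBall (0 : EuclideanSpace ℝ (Fin 3)) r)
    (hdivη : ∫ x, ⟪U x, gradient (fun y => kwonCutoff y *
      VectorCalculus.divergence (testPotential η) y) x⟫ = 0)
    (hdivΔ : ∫ x, ⟪U x, gradient (fun y => kwonCutoff y *
      VectorCalculus.divergence (testPotential fun z => (Δ ξ) z) y) x⟫ = 0) :
    ∫ x, (⟪U x, testField η x⟫ + ⟪U x, fderiv ℝ (testField ξ) x (U x)⟫ + ⟪U x, (Δ (testField ξ)) x⟫) =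
      ∫ x, (⟪U x - harmonicPart U x, η x⟫
        + ⟪U x - harmonicPart U x, fderiv ℝ ξ x (U x - harmonicPart U x)⟫
        + ⟪harmonicPart U x, fderiv ℝ ξ x (U x - harmonicPart U x)⟫
        + ⟪U x - harmonicPart U x, fderiv ℝ ξ x (harmonicPart U x)⟫
        + ⟪U x - harmonicPart U x, (Δ ξ) x⟫
        + kwonSlicePressure U x * VectorCalculus.divergence ξ x
        + ⟪kwonSliceForce U x, ξ x⟫) := by
  have hξc := hasCompactSupport_of_tsupport_subset_closedBall hξs
  have hηc := hasCompactSupport_of_tsupport_subset_closedBall hηs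
  have hζ : ContDiff ℝ ∞ (testField ξ) := contDiff_testField hξ hξc
  have hζc : HasCompactSupport (testField ξ) := hasCompactSupport_testField
  -- left-hand integrands
  have l1 : Integrable fun x => ⟪U x, testField η x⟫ :=
    integrable_inner_density hU1 (contDiff_testField hη hηc (n := 0)).continuous hasCompactSupport_testField
  have l2 : Integrable fun x => ⟪U x, fderiv ℝ (testField ξ) x (U x)⟫ :=
    integrable_inner_clm_apply_self hUm hU2 ((contDiff_infty.1 hζ 1).continuous_fderiv one_ne_zero)
      (hζc.fderiv (𝕜 := ℝ))
  have l3 : Integrable fun x => ⟪U x, (Δ (testField ξ)) x⟫ :=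
    integrable_inner_density hU1 (contDiff_laplacian_infty hζ).continuous
      (hasCompactSupport_of_tsupport_subset_closedBall
        ((tsupport_laplacian_subset' (testField ξ)).trans tsupport_testField_subset))
  -- right-hand integrands
  have r1 : Integrable fun x => ⟪U x - harmonicPart U x, η x⟫ :=
    integrable_inner_sub_harmonicPart hU1 hη.continuous hηc
  obtain ⟨r2, r3, r4⟩ := integrable_perturbed_convective hUm hU1 hU2 hξ hξc
  have r5 : Integrable fun x => ⟪U x - harmonicPart U x, (Δ ξ) x⟫ :=
    integrable_inner_sub_harmonicPart hU1 (contDiff_laplacian_infty hξ).continuous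
      (hasCompactSupport_of_tsupport_subset_closedBall ((tsupport_laplacian_subset' ξ).trans hξs))
  have r6 := integrable_kwonSlicePressure_mul hUm hU1 hU2 hU3 hξ hξc
  have r7 := integrable_inner_kwonSliceForce hUm hU1 hU2 hξ hξc
  have l12 : Integrable fun x => ⟪U x, testField η x⟫ + ⟪U x, fderiv ℝ (testField ξ) x (U x)⟫ := l1.add l2
  have r12 : Integrable fun x => ⟪U x - harmonicPart U x, η x⟫
      + ⟪U x - harmonicPart U x, fderiv ℝ ξ x (U x - harmonicPart U x)⟫ := r1.add r2
  have r123 : Integrable fun x => ⟪U x - harmonicPart U x, η x⟫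
      + ⟪U x - harmonicPart U x, fderiv ℝ ξ x (U x - harmonicPart U x)⟫
      + ⟪harmonicPart U x, fderiv ℝ ξ x (U x - harmonicPart U x)⟫ := r12.add r3
  have r1234 : Integrable fun x => ⟪U x - harmonicPart U x, η x⟫
      + ⟪U x - harmonicPart U x, fderiv ℝ ξ x (U x - harmonicPart U x)⟫
      + ⟪harmonicPart U x, fderiv ℝ ξ x (U x - harmonicPart U x)⟫
      + ⟪U x - harmonicPart U x, fderiv ℝ ξ x (harmonicPart U x)⟫ := r123.add r4
  have r12345 : Integrable fun x => ⟪U x - harmonicPart U x, η x⟫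
      + ⟪U x - harmonicPart U x, fderiv ℝ ξ x (U x - harmonicPart U x)⟫
      + ⟪harmonicPart U x, fderiv ℝ ξ x (U x - harmonicPart U x)⟫
      + ⟪U x - harmonicPart U x, fderiv ℝ ξ x (harmonicPart U x)⟫
      + ⟪U x - harmonicPart U x, (Δ ξ) x⟫ := r1234.add r5
  have r123456 : Integrable fun x => ⟪U x - harmonicPart U x, η x⟫
      + ⟪U x - harmonicPart U x, fderiv ℝ ξ x (U x - harmonicPart U x)⟫
      + ⟪harmonicPart U x, fderiv ℝ ξ x (U x - harmonicPart U x)⟫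
      + ⟪U x - harmonicPart U x, fderiv ℝ ξ x (harmonicPart U x)⟫
      + ⟪U x - harmonicPart U x, (Δ ξ) x⟫
      + kwonSlicePressure U x * VectorCalculus.divergence ξ x := r12345.add r6
  rw [integral_add l12 l3, integral_add l1 l2, integral_add r123456 r7, integral_add r12345 r6,
    integral_add r1234 r5, integral_add r123 r4, integral_add r12 r3, integral_add r1 r2]
  exact slice_momentum_identity hUm hU1 hU2 hU3 hξ hη hr hξs hηs hdivη hdivΔ

end Combined

end Kwon2023

end Literature.Analysis.FluidPDE

end
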